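import Literature.NumberTheory.QuadraticFields.QuadraticDedekindZetaKronecker
import Literature.NumberTheory.LFunctions.RayClassLSeriesAtOneLimitProofs
import Mathlib.NumberTheory.LSeries.Convolution
import Mathlib.NumberTheory.LSeries.Injectivity
import HarnessLib

/-!
# The Artin–Hecke factorisation for a quadratic field: `L_K(s, χ∘N_{K/ℚ}) = L(s, χ)·L(s, χχ_K)` (`Re s > 1`)
# — for every quadratic field `K`, every Dirichlet character `χ`, with `χ_K` the Kronecker character —
# and the ideal-counting identity `#{𝔞 : N𝔞 = n} = Σ_{d ∣ n} χ_K(d)`; everything PROVED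

Topic `Literature/NumberTheory/LFunctions` (namespace = path).  Typed by seat `bsd-cm-prr-ty1` g27 (literature-prover,
cell bsd-cm) on the planner's word D876 (2)(β): typing-map `GenusTypingMap-g57.md` row **A7**, the last Literature input
of road R2 of crux `EllipticUnitValueSevenOfGZK` (stmt-BirchSwinnertonDyer-19945; K1ᵘ audit item (e) of the frozen memo
`MEMO-bsd-cm-genus` §7).  THEOREMS ONLY plus one definition with a body (the base-changed character on prime ideals);
no named fact (net debt 0), no `instance`, no notation, no `sorry`.  Nothing about an elliptic curve or BSD is claimed.

## The printed statement

J. Neukirch, *Algebraic Number Theory* (1999), Ch. VII §8, display after (8.1) (the `L`-series of a character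
`mod 𝔪`) and **§10, Prop. (10.4) (ii) + (iv) (p. 522: additivity and `𝓛(L|M, χ, s) = 𝓛(L|K, χ_*, s)` for the
induced character), Cor. (10.5) (p. 524: `ζ_L(s) = ζ_K(s) ∏_{χ ≠ 1} 𝓛(L|K, χ, s)^{χ(1)}`), Thm. (10.6) (p. 525: Artin =
Hecke `L`-series for abelian `L|K`)** — for the quadratic base change `K/ℚ` and a Dirichlet character `χ` of `ℚ`:
`Ind_{G_K}^{G_ℚ}(χ|_{G_K}) = χ ⊕ χχ_K`, hence `L_K(s, χ∘N_{K/ℚ}) = L(s, χ) L(s, χχ_K)`; S. Lang, *Algebraic Number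
Theory*, Ch. XII §1 (factorisation of the zeta function of an abelian extension); for `χ = 1` this is `ζ_K(s) = ζ(s) L(s, χ_K)` — Neukirch VII (5.12) for quadratic
fields, the TREE theorem `Quadratic.dedekindZeta_eq_riemannZeta_mul_LSeries_of_kronecker`
(`QuadraticFields/QuadraticDedekindZetaKronecker.lean`), whose local Euler factors
`finprod_primesOver_eq_of_kronecker` (Cox Prop. 5.16) are the whole arithmetic content.  Here the twisted identity is
DERIVED from the tree theorem by Dirichlet-coefficient comparison (Mathlib `LSeries.eq_of_LSeries_eventually_eq`,
`LSeries_convolution'`): no new Euler-product manipulation.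

## What is typed (currency of the tree: Neukirch's `rayClassLSeries 𝔪 ψ s = Σ_𝔞 χ(𝔞) N𝔞^{−s}` of
## `LFunctions/RayClassCharacter.lean`, and Mathlib's `LSeries`)

* `absNormChar χ : HeightOneSpectrum (𝓞 K) → ℂ`, `𝔭 ↦ χ(N𝔭)` — the character `χ∘N_{K/ℚ}` on prime ideals (definition with
  a body); `idealPow_absNormChar : idealPow K (absNormChar χ) 𝔞 = χ(N𝔞)` (`𝔞 ≠ 0`; unique factorisation + complete
  multiplicativity of `χ` and of `N`); `rayClassCoeff_absNormChar : rayClassCoeff (M) (absNormChar χ) 𝔞 = χ(N𝔞)` for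
  `N𝔞 ≠ 0` (both sides vanish when `(N𝔞, M) ≠ 1`, since `(𝔞, M𝓞_K) = 1 ⇔ (N𝔞, M) = 1` fails exactly when `χ(N𝔞) = 0`).
* `card_ideals_absNorm_eq_sum_kronecker` — **`#{𝔞 ⊆ 𝓞 K : N𝔞 = n} = Σ_{d ∣ n} χ_K(d)`** (`n ≠ 0`), read off
  `ζ_K = ζ·L(χ_K)` by injectivity of the Dirichlet transform (Mathlib).
* `rayClassLSeries_absNormChar_eq` — **A7: `L_K(s, χ∘N) = L(s, χ)·L(s, χχ_K)` for `Re s > 1`**, precisely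
  `rayClassLSeries (span {M}) (absNormChar χ) s = LSeries (n ↦ χ n) s * LSeries (n ↦ χ n · χ_K n) s`, where `χ` is a
  Dirichlet character mod `M ≠ 0` and `χ_K` ANY Dirichlet character with the Kronecker values of `K` (hypotheses
  `hoddp`, `htwo` verbatim from the tree theorem; for odd `d_K` the tree's `jacobiChar |d_K|`, for even `d_K` the character
  of `KroneckerCharacterFourProofs.lean`).  The second factor is the `L`-series of the function `n ↦ χ(n)χ_K(n)` — the
  (possibly imprimitive) product character; primitivity is not discussed (row A6's comparison is a separate matter).
  Also the coefficient form `LSeries (n ↦ χ n · #{𝔞 : N𝔞 = n}) s = …` (`LSeries_twisted_card_eq`).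
SPECIAL CASE of print: `K/ℚ` quadratic (Neukirch/Lang: any abelian extension and any character of the base);
`Re s > 1` only (no continuation is discussed).
-- TODO(general form): `L_K(s, χ∘N_{K/k}) = ∏_{ψ ∈ Gal(K/k)^∨} L_k(s, χψ)` for an abelian extension `K/k` of number
-- fields (Neukirch VII (10.6)), and the identity of the continued functions on all of `ℂ`.

## References

* [NeukirchANT1999] J. Neukirch, *Algebraic Number Theory* (1999), Ch. VII §5 (5.12), §8 (8.1), §10 Prop. (10.4) (ii)/(iv)
  (p. 522), Cor. (10.5) (p. 524), Thm. (10.6) (p. 525) [corpus:book:bynd-algebraic-number-theory p0458–p0461].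
* [LangANT1994] S. Lang, *Algebraic Number Theory*, 2nd ed. (1994), Ch. XII §1.
* [Cox2013] D. A. Cox, *Primes of the form x² + ny²*, 2nd ed. (2013), Prop. 5.16 (through the tree theorem).
* Tree: `QuadraticFields/QuadraticDedekindZetaKronecker.lean` (`dedekindZeta_eq_riemannZeta_mul_LSeries_of_kronecker`),
  `LFunctions/RayClassCharacter.lean` (`idealPow`, `rayClassCoeff`, `rayClassLSeries`), `LFunctions/RayClassLSeriesAtOneLimitProofs.lean`
  (`rayClassLSeries_eq_LSeries`), `LFunctions/DedekindZeta.lean` (`LSeriesSummable_dedekindZeta`); Mathlib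
  `NumberTheory/LSeries/{Convolution,Injectivity,Dirichlet}.lean`.
-/

noncomputable section

open scoped LSeries.notation
open NumberField Ideal IsDedekindDomain Filter

namespace Literature.NumberTheory.LFunctions

variable {K : Type*} [Field K] [NumberField K]

/-! ## §1 The base-changed character `χ∘N_{K/ℚ}` on ideals -/

section AbsNormChar

variable {M : ℕ} (χ : DirichletCharacter ℂ M)

/-- **`(χ∘N_{K/ℚ})(𝔭) := χ(N𝔭)`** — the Dirichlet character `χ` composed with the absolute norm, as a function on the
non-zero prime ideals of `𝓞 K` (the datum `ψ` of Neukirch's characters `mod 𝔪` in `LFunctions/RayClassCharacter.lean`).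
[cite: NeukirchANT1999, Ch. VII §8 (8.1) and §10 Prop. (10.4) (iv) (p. 522)] -/
def absNormChar (v : HeightOneSpectrum (𝓞 K)) : ℂ :=
  χ (Ideal.absNorm v.asIdeal : ZMod M)

/-- Unfolding `absNormChar`. [cite: NeukirchANT1999, Ch. VII §8 (8.1)] -/
theorem absNormChar_apply (v : HeightOneSpectrum (𝓞 K)) :
    absNormChar (K := K) χ v = χ (Ideal.absNorm v.asIdeal : ZMod M) :=
  rfl

/-- `|χ(N𝔭)| ≤ 1`. [cite: NeukirchANT1999, Ch. VII §8 (8.1)] -/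
theorem norm_absNormChar_le_one (v : HeightOneSpectrum (𝓞 K)) : ‖absNormChar (K := K) χ v‖ ≤ 1 :=
  χ.norm_le_one _

/-- **`χ(𝔞) = χ(N𝔞)`**: the multiplicative extension `idealPow` of `𝔭 ↦ χ(N𝔭)` to a non-zero ideal `𝔞` is `χ(N𝔞)`
(unique factorisation in `𝓞 K`; `N` and `χ` are multiplicative). [cite: NeukirchANT1999, Ch. VII §8 (8.1) with Ch. I (3.3)] -/
theorem idealPow_absNormChar {I : Ideal (𝓞 K)} (hI : I ≠ ⊥) :
    idealPow K (absNormChar χ) I = χ (Ideal.absNorm I : ZMod M) := by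
  induction I using UniqueFactorizationMonoid.induction_on_prime with
  | h₁ => exact absurd rfl hI
  | h₂ J hJ =>
    rw [Ideal.isUnit_iff] at hJ
    subst hJ
    rw [idealPow_top, ← Ideal.one_eq_top, map_one, Nat.cast_one, map_one]
  | h₃ J P hJ hP ih =>
    have hP0 : P ≠ ⊥ := hP.ne_zero
    have hPprime : P.IsPrime := Ideal.isPrime_of_prime hP
    let v : HeightOneSpectrum (𝓞 K) := ⟨P, hPprime, hP0⟩
    rw [idealPow_mul _ hP0 hJ, ih hJ, show P = v.asIdeal from rfl, idealPow_asIdeal, absNormChar_apply, map_mul,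
      Nat.cast_mul, map_mul]

/-- For an ideal `𝔞` with `N𝔞 = n ≠ 0`: `𝔞` is prime to `M·𝓞 K` iff `(n, M) = 1` — one direction suffices here: if
`𝔞` is NOT prime to `(M)` then `χ(N𝔞) = 0`. [cite: NeukirchANT1999, Ch. VII §8 (8.1)] -/
theorem apply_absNorm_eq_zero_of_not_isCoprime {I : Ideal (𝓞 K)}
    (h : ¬ IsCoprime I (Ideal.span {((M : ℕ) : 𝓞 K)})) : χ (Ideal.absNorm I : ZMod M) = 0 := by
  classical
  -- a common prime factor `v` of `I` and `(M)`
  rw [Ideal.isCoprime_iff_sup_eq, ← Ne, ← lt_top_iff_ne_top] at h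
  obtain ⟨Q, hQmax, hle⟩ := Ideal.exists_le_maximal _ h.ne
  have hIQ : I ≤ Q := le_sup_left.trans hle
  have hMQ : ((M : ℕ) : 𝓞 K) ∈ Q := hle (Ideal.mem_sup_right (Ideal.mem_span_singleton_self _))
  -- `N Q ∣ N I` and `N Q ∣ N (M) = M^{[K:ℚ]}`, and `N Q > 1`
  have hdvdI : Ideal.absNorm Q ∣ Ideal.absNorm I := Ideal.absNorm_dvd_absNorm_of_le hIQ
  have hdvdM : Ideal.absNorm Q ∣ Ideal.absNorm (Ideal.span {((M : ℕ) : 𝓞 K)}) :=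
    Ideal.absNorm_dvd_absNorm_of_le ((Ideal.span_singleton_le_iff_mem _).mpr hMQ)
  rw [Ideal.absNorm_span_singleton, ← map_natCast (algebraMap ℤ (𝓞 K)) M, Algebra.norm_algebraMap, Int.natAbs_pow,
    Int.natAbs_natCast] at hdvdM
  have hQ1 : Ideal.absNorm Q ≠ 1 := by
    rw [Ne, Ideal.absNorm_eq_one_iff]; exact hQmax.ne_top
  -- hence `(N I, M) ≠ 1` and `χ(N I) = 0`
  apply χ.map_nonunit
  rw [ZMod.isUnit_iff_coprime]
  intro hcop
  obtain ⟨q, hq, hqQ⟩ := Nat.ne_one_iff_exists_prime_dvd.mp hQ1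
  have h1 : q ∣ Ideal.absNorm I := hqQ.trans hdvdI
  have h2 : q ∣ M := hq.dvd_of_dvd_pow (hqQ.trans hdvdM)
  exact hq.one_lt.ne' (Nat.eq_one_of_dvd_coprimes hcop h1 h2)

/-- **The coefficient of Neukirch's series at the modulus `(M)` IS `χ(N𝔞)`** for every ideal of non-zero norm (the
cut-off «`χ(𝔞) = 0` whenever `(𝔞, 𝔪) ≠ 1`» costs nothing: there `χ(N𝔞) = 0` as well).
[cite: NeukirchANT1999, Ch. VII §8 (8.1)] -/
theorem rayClassCoeff_absNormChar {I : Ideal (𝓞 K)} (hI : I ≠ ⊥) :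
    rayClassCoeff (Ideal.span {((M : ℕ) : 𝓞 K)}) (absNormChar χ) I = χ (Ideal.absNorm I : ZMod M) := by
  classical
  unfold rayClassCoeff
  split_ifs with h
  · exact idealPow_absNormChar χ hI
  · rw [not_and_or] at h
    rcases h with h | h
    · exact absurd hI h
    · exact (apply_absNorm_eq_zero_of_not_isCoprime χ h).symm

end AbsNormChar

/-! ## §2 `#{𝔞 : N𝔞 = n} = Σ_{d ∣ n} χ_K(d)` from `ζ_K = ζ · L(χ_K)` -/

section Quadratic

open Literature.NumberTheory.QuadraticFields

variable {M N : ℕ} (χ : DirichletCharacter ℂ M) (κ : DirichletCharacter ℂ N)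

/-- The Dirichlet series of ideal counts converges at `s = 2` (so its abscissa is finite). [cite: NeukirchANT1999, Ch. VII §5 (5.2)] -/
theorem abscissaOfAbsConv_card_ideals_lt_top :
    LSeries.abscissaOfAbsConv (fun n ↦ (Nat.card {I : Ideal (𝓞 K) // Ideal.absNorm I = n} : ℂ)) < ⊤ :=
  lt_of_le_of_lt (LSeriesSummable_dedekindZeta (K := K) (s := 2) (by norm_num)).abscissaOfAbsConv_le
    (EReal.coe_lt_top _)

/-- **`#{𝔞 ⊆ 𝓞 K : N𝔞 = n} = Σ_{d ∣ n} χ_K(d)` for `n ≠ 0`** — the Dirichlet coefficients of `ζ_K(s) = ζ(s)·L(s, χ_K)`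
(tree theorem `Quadratic.dedekindZeta_eq_riemannZeta_mul_LSeries_of_kronecker`) compared by injectivity of the Dirichlet
transform; `χ_K` is any Dirichlet character with the Kronecker values of the quadratic field `K`.
[cite: NeukirchANT1999, Ch. VII §5 (5.12)] [cite: Cox2013, §5.B Prop. 5.16] -/
theorem card_ideals_absNorm_eq_convolution (h2 : Module.finrank ℚ K = 2) [NeZero N]
    (hoddp : ∀ p : ℕ, p.Prime → p ≠ 2 → κ p = (jacobiSym (NumberField.discr K) p : ℂ))
    (htwo : κ 2 = if NumberField.discr K % 8 = 1 then 1
      else if NumberField.discr K % 8 = 5 then -1 else 0) {n : ℕ} (hn : n ≠ 0) :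
    (Nat.card {I : Ideal (𝓞 K) // Ideal.absNorm I = n} : ℂ) = ((fun _ : ℕ ↦ (1 : ℂ)) ⍟ (fun m ↦ κ m)) n := by
  refine LSeries.eq_of_LSeries_eventually_eq abscissaOfAbsConv_card_ideals_lt_top ?_ ?_ hn
  · -- abscissa of `1 ⍟ κ` is finite: summable at `2`
    have h1 : LSeriesSummable (fun _ : ℕ ↦ (1 : ℂ)) (2 : ℂ) := LSeriesSummable_one_iff.mpr (by norm_num)
    have h2' : LSeriesSummable (fun m : ℕ ↦ κ m) (2 : ℂ) := κ.LSeriesSummable_of_one_lt_re (by norm_num)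
    exact lt_of_le_of_lt (h1.convolution h2').abscissaOfAbsConv_le (EReal.coe_lt_top _)
  · rw [EventuallyEq, eventually_atTop]
    refine ⟨2, fun x hx ↦ ?_⟩
    have hx' : 1 < (x : ℂ).re := by rw [Complex.ofReal_re]; linarith
    have hζ := Quadratic.dedekindZeta_eq_riemannZeta_mul_LSeries_of_kronecker h2 κ hoddp htwo hx'
    rw [NumberField.dedekindZeta] at hζ
    have h1 : LSeriesSummable (fun _ : ℕ ↦ (1 : ℂ)) (x : ℂ) := LSeriesSummable_one_iff.mpr hx'
    rw [hζ, ← LSeries_one_eq_riemannZeta hx', LSeries_convolution' h1 (κ.LSeriesSummable_of_one_lt_re hx')]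
    rfl

/-- The same identity as a divisor sum: `#{𝔞 : N𝔞 = n} = Σ_{d ∣ n} χ_K(d)` (`n ≠ 0`).
[cite: NeukirchANT1999, Ch. VII §5 (5.12)] [cite: Cox2013, §5.B Prop. 5.16] -/
theorem card_ideals_absNorm_eq_sum_kronecker (h2 : Module.finrank ℚ K = 2) [NeZero N]
    (hoddp : ∀ p : ℕ, p.Prime → p ≠ 2 → κ p = (jacobiSym (NumberField.discr K) p : ℂ))
    (htwo : κ 2 = if NumberField.discr K % 8 = 1 then 1
      else if NumberField.discr K % 8 = 5 then -1 else 0) {n : ℕ} (hn : n ≠ 0) :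
    (Nat.card {I : Ideal (𝓞 K) // Ideal.absNorm I = n} : ℂ) = ∑ d ∈ n.divisors, κ d := by
  rw [card_ideals_absNorm_eq_convolution κ h2 hoddp htwo hn, LSeries.convolution_def]
  dsimp only
  simp only [one_mul]
  rw [← Nat.map_div_left_divisors, Finset.sum_map]
  rfl

/-! ## §3 The twisted coefficients and A7 -/

/-- Pointwise: `χ(n)·(1 ⍟ κ)(n) = (χ ⍟ χκ)(n)` — `χ` is completely multiplicative (`χ(n) = χ(k)χ(m)` for `km = n`).
[cite: NeukirchANT1999, Ch. VII §10 Prop. (10.4) (ii), (iv) (p. 522)] -/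
theorem mul_convolution_one_eq (n : ℕ) :
    χ n * ((fun _ : ℕ ↦ (1 : ℂ)) ⍟ (fun m ↦ κ m)) n =
      ((fun m : ℕ ↦ χ m) ⍟ (fun m ↦ χ m * κ m)) n := by
  rw [LSeries.convolution_def, LSeries.convolution_def]
  dsimp only
  rw [Finset.mul_sum]
  refine Finset.sum_congr rfl fun q hq ↦ ?_
  have hkm : q.1 * q.2 = n := (Nat.mem_divisorsAntidiagonal.mp hq).1
  rw [← hkm, Nat.cast_mul, map_mul]
  ring

/-- **The twisted ideal count**: `χ(n)·#{𝔞 : N𝔞 = n} = (χ ⍟ χχ_K)(n)` for `n ≠ 0`.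
[cite: NeukirchANT1999, Ch. VII §10 Prop. (10.4) (ii), (iv) (p. 522)] -/
theorem mul_card_ideals_absNorm_eq_convolution (h2 : Module.finrank ℚ K = 2) [NeZero N]
    (hoddp : ∀ p : ℕ, p.Prime → p ≠ 2 → κ p = (jacobiSym (NumberField.discr K) p : ℂ))
    (htwo : κ 2 = if NumberField.discr K % 8 = 1 then 1
      else if NumberField.discr K % 8 = 5 then -1 else 0) {n : ℕ} (hn : n ≠ 0) :
    χ n * (Nat.card {I : Ideal (𝓞 K) // Ideal.absNorm I = n} : ℂ) =
      ((fun m : ℕ ↦ χ m) ⍟ (fun m ↦ χ m * κ m)) n := by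
  rw [card_ideals_absNorm_eq_convolution κ h2 hoddp htwo hn, mul_convolution_one_eq]

/-- **Coefficient form of A7**: `Σ_n χ(n)·#{𝔞 : N𝔞 = n}·n^{−s} = L(s, χ)·L(s, χχ_K)` for `Re s > 1`.
[cite: NeukirchANT1999, Ch. VII §10 Prop. (10.4) (ii), (iv) (p. 522), Cor. (10.5) (p. 524), Thm. (10.6) (p. 525)] [cite: LangANT1994, Ch. XII §1] -/
theorem LSeries_twisted_card_eq (h2 : Module.finrank ℚ K = 2) [NeZero N]
    (hoddp : ∀ p : ℕ, p.Prime → p ≠ 2 → κ p = (jacobiSym (NumberField.discr K) p : ℂ))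
    (htwo : κ 2 = if NumberField.discr K % 8 = 1 then 1
      else if NumberField.discr K % 8 = 5 then -1 else 0) {s : ℂ} (hs : 1 < s.re) :
    LSeries (fun n ↦ χ n * (Nat.card {I : Ideal (𝓞 K) // Ideal.absNorm I = n} : ℂ)) s =
      LSeries (fun n ↦ χ n) s * LSeries (fun n ↦ χ n * κ n) s := by
  have hχκ : LSeriesSummable (fun n : ℕ ↦ χ n * κ n) s := by
    refine LSeriesSummable_of_bounded_of_one_lt_re (m := 1) (fun n _ ↦ ?_) hs
    rw [norm_mul]
    exact mul_le_one₀ (χ.norm_le_one _) (norm_nonneg _) (κ.norm_le_one _)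
  rw [← LSeries_convolution' (χ.LSeriesSummable_of_one_lt_re hs) hχκ]
  refine LSeries_congr (fun {n} hn ↦ ?_) s
  exact mul_card_ideals_absNorm_eq_convolution χ κ h2 hoddp htwo hn

/-- **A7 — `L_K(s, χ∘N_{K/ℚ}) = L(s, χ)·L(s, χχ_K)` for `Re s > 1`**, for every quadratic field `K` (`[K : ℚ] = 2`, any
discriminant), every Dirichlet character `χ` mod `M ≠ 0`, and any Dirichlet character `χ_K` with the Kronecker values of
`K`: Neukirch's series `Σ_𝔞 χ(𝔞)N𝔞^{−s}` for the character `𝔞 ↦ χ(N𝔞)` mod `(M)` (tree `rayClassLSeries`, `(8.1)`) equals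
the product of the two Dirichlet `L`-series (the second for the function `n ↦ χ(n)χ_K(n)`, the possibly imprimitive product
character).  Proof: regroup by the norm (`rayClassLSeries_eq_LSeries`), identify the coefficient `χ(N𝔞) = χ(n)` on the
fibre `N𝔞 = n` (`rayClassCoeff_absNormChar`), then `LSeries_twisted_card_eq`.  SPECIAL CASE (`K/ℚ` quadratic, `Re s > 1`)
of the factorisation of `L`-series under abelian base change.
[cite: NeukirchANT1999, Ch. VII §10 Prop. (10.4) (ii), (iv) (p. 522), Cor. (10.5) (p. 524), Thm. (10.6) (p. 525); §8 (8.1); §5 (5.12)] [cite: LangANT1994, Ch. XII §1] -/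
theorem rayClassLSeries_absNormChar_eq (h2 : Module.finrank ℚ K = 2) [NeZero M] [NeZero N]
    (hoddp : ∀ p : ℕ, p.Prime → p ≠ 2 → κ p = (jacobiSym (NumberField.discr K) p : ℂ))
    (htwo : κ 2 = if NumberField.discr K % 8 = 1 then 1
      else if NumberField.discr K % 8 = 5 then -1 else 0) {s : ℂ} (hs : 1 < s.re) :
    rayClassLSeries (Ideal.span {((M : ℕ) : 𝓞 K)}) (absNormChar χ) s =
      LSeries (fun n ↦ χ n) s * LSeries (fun n ↦ χ n * κ n) s := by
  classical
  have hM : (Ideal.span {((M : ℕ) : 𝓞 K)}) ≠ ⊥ := by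
    rw [Ne, Ideal.span_singleton_eq_bot]
    exact_mod_cast (NeZero.ne M)
  rw [rayClassLSeries_eq_LSeries hM (fun v _ ↦ norm_absNormChar_le_one χ v) hs, ← LSeries_twisted_card_eq χ κ h2 hoddp htwo hs]
  refine LSeries_congr (fun {n} hn ↦ ?_) s
  -- on the fibre `N𝔞 = n ≠ 0` every coefficient is `χ(n)`
  have hfib : ∀ I ∈ (Ideal.finite_setOf_absNorm_eq (S := 𝓞 K) n).toFinset,
      rayClassCoeff (Ideal.span {((M : ℕ) : 𝓞 K)}) (absNormChar χ) I = χ n := by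
    intro I hI
    rw [Set.Finite.mem_toFinset, Set.mem_setOf_eq] at hI
    have hI0 : I ≠ ⊥ := by
      rintro rfl
      rw [Ideal.absNorm_bot] at hI
      exact hn hI.symm
    rw [rayClassCoeff_absNormChar χ hI0, hI]
  rw [Finset.sum_congr rfl hfib, Finset.sum_const, nsmul_eq_mul, mul_comm]
  congr 1
  rw [← Nat.card_eq_card_finite_toFinset (Ideal.finite_setOf_absNorm_eq (S := 𝓞 K) n)]
  rfl

end Quadratic

end Literature.NumberTheory.LFunctions

end
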